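import Mathlib
import HarnessLib
import HarnessLib.Audit
import Summits.AtomisticToContinuum.Statement
import Literature.MathematicalPhysics.QuantumManyBody.PeriodicBoseGasJastrow
import HarnessLib.Audit.Status.Attr

/-!
Route: BECJastrowEulerLagrange

DORMANT since 2026-08-29T19:27:37Z (census g0: costume|duplicate of —; reader census-reader-32-g0) — unstaffed, not closed; items shared with open routes are served there. `ledger route dormant <id> --off` reactivates.

# Route BECJastrowEulerLagrange — Jastrow rigidity — energy is sharp on the pair-product manifold;
optimal pair factor = Riesz-2 tail, its BEC, and a conditional shadow transfer to the ground state

It suffices to show X = (JASTROW RIGIDITY PACKAGE) ∧ (SHADOW TRANSFER) ∧ (BOUNDARY TRANSFER),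
realising card jastrow-rigidity-euler-lagrange
(spine; gen-2 re-opening of the retired route-AtomisticToContinuum-BECJastrowRigidity, whose only
recorded defect was an Assembly naming the
Literature constant instead of the sub-problem decl). Work on the torus of side L = (N/ρ)^(1/3) and
on the PAIR-PRODUCT (Jastrow) MANIFOLD
𝓙(N,L) = {Ψ_φ = ∏_(i<j) φ(x_i − x_j)/‖·‖ : φ C¹ even, 0 ≤ φ ≤ 1, φ = 1 off a ball of radius b < L/2}
— exactly the in-tree `IsPairProfile.trialState`
states of LSSY Thm 2.2 — with Jastrow infimum E_J(N,L) = inf_𝓙 periodicEnergy. PACKAGE: (i)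
JastrowTailRigidity (rank 2) — every near-optimal pair
factor carries the Reatto–Chester / Riesz-2 tail 1 − φ ≈ √(a/π³ρ)/r², i.e. |k|·(1−φ)^(k) =
2√(πa/ρ)(1 ± ε) on all torus modes M/L ≤ |k| ≤ κ√(ρa),
uniformly in N (energy minimisation on 𝓙 selects the infrared class scale by scale, although in the
full Hilbert space energy to LHY precision is
blind to condensation); (ii) OptimalJastrowBEC (rank 3) — near-optimal Jastrow states have
constant-mode occupation ≥ cN uniformly in N.
SHADOW TRANSFER (rank 5, the explicitly CONDITIONAL link delegated by the card to cards
riesz-shadow-harmonic-extension R3 /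
relative-fisher-landscape-transfer): (i) and (ii) imply constant-mode BEC of near-minimisers of the
FULL periodic energy for every admissible v
(the PeriodicBEC body, stmt-0826). BOUNDARY TRANSFER = the shared item BoundaryTransferWeak
(stmt-AtomisticToContinuum-0827, verbatim).
Outside the deciding chain, of independent value: JastrowLHYSharp (rank 4) — the pair-product
manifold ALONE is Lee–Huang–Yang sharp
(named an open 'challenge' in BastiEtAl2026 pp. 4–5, who prove the hard-sphere LHY upper bound only
with a Jastrow∘Bogoliubov Fock state).
Lean: `JastrowTailRigidity ∧ OptimalJastrowBEC ∧ JastrowShadowTransfer ∧ BoundaryTransferWeak`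
(decls of this route, bodies under Cruxes; all elaborate in Sketch.lean rc 0 over
Literature.MathematicalPhysics.QuantumManyBody.BoseGas.{IsRepulsiveFiniteRange, IsPairProfile,
IsPairProfile.trialState, jastrowNormR, periodicEnergy, periodicGroundStateEnergy,
condensateOccupation, PeriodicTrialState, scatteringLength, latticeVec, sideLength,
HasGroundStateBEC} and `_root_.BoseEinsteinCondensation`)

## Assembly
Pure logic (Sketch.lean rc 0, axioms propext / Classical.choice / Quot.sound). The deciding theorem
is
`theorem closes (hT : JastrowTailRigidity) (hB : OptimalJastrowBEC) (hS : JastrowShadowTransfer) (hW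
: BoundaryTransferWeak) : _root_.BoseEinsteinCondensation := fun v hv => hW v hv (hS hT hB v hv)`:
the bridge turns the two package cruxes into the PeriodicBEC statement, specialised at v it is the
hypothesis of BoundaryTransferWeak v hv, whose
conclusion ∃ρ₀ ∀ρ<ρ₀ HasGroundStateBEC v ρ is the body of the conjunct
`_root_.BoseEinsteinCondensation` (root abbrev of the Literature statement,
unfolded by `fun v hv =>`). `example : Assembly := closes` checks that the Assembly item is
literally its type. JastrowLHYSharp and
JastrowInfLeadingOrder are deliberately not hypotheses of `closes`.

Rationale: WHY THIS LINE. Mechanism (card jastrow-rigidity-euler-lagrange; physics ReattoChester1967,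
CampbellFeenberg1969 paired-phonon analysis, Griffin1993 (9.3) p.183
read): restricted to positive pair-product states the energy functional has a three-body kinetic
cross term whose long-wavelength Euler–Lagrange
equation ρû(k) ≈ ½(1/S(k) − 1) with S(k) ≈ k/c admits ONLY the exponent-2 tail, and each infrared
band of torus modes carries a total energy
≍ 8πρa·#modes that pins the tail of near-minimisers scale by scale up to the box ('Jastrow
rigidity'); the phase-texture / Galilei-boost /
number-filter witnesses of energy blindness (KineticGapLengthScalesNarrow conjunct (2), route
NumberFilterBlindness) are not tangent to the
manifold. Imported area: classical statistical mechanics of long-range Riesz (s = d−1 = 2) gases —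
|Ψ_φ|² IS a pair-potential Gibbs measure —
via LebleSerfaty2017 / Serfaty2024 local laws and FrohlichPark1978-type correlation inequalities,
replacing the short-range cluster expansions of
BastiEtAl2024 (pure cut-off Jastrow: LHY order, wrong constant; arXiv:2603.13084 p.2) and
LauritsenSeiringer2024 (rigorous
Gaudin–Gillespie–Ripka expansion, integrable pair factors only), both of which stop at ρaℓ² ≪ 1,
i.e. exactly where the phonon tail begins
(arXiv:2603.13084 pp.4–5). What prior routes do not do: the open Jastrow-named route BECParentAnchor
fixes a SHORT-range pair factor and perturbs
its parent Hamiltonian; BECRieszShadow proves condensation of GIVEN Riesz-tailed shadows and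
conjectures the class of Ψ₀; here the pair factor is
the unknown and the theorem-candidate is that the energy-optimal one is long-range with exponent 2
and condenses. Versus the retired gen-1 route:
the deciding theorem now concludes `_root_.BoseEinsteinCondensation`; the bridge is re-drawn so that
the namesake crux JastrowTailRigidity is
load-bearing (structure, not LHY-accuracy, is what a transfer can use at the box scale —
KineticGapLengthScalesNarrow (3)), and
JastrowLHYSharp is decoupled from the deciding chain (its possible failure with the exact constant,
flagged by two audits, no longer breaks the
logic). Negatives index (6 entries, 1 in this sub: BECSwapAffinity SwapJensen) steered clear of: no
swap-affinity / Jensen statement is used.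

RANKED CRUXES. #2 JastrowTailRigidity (crux) — (card D2, TAIL THEOREM, uniform-in-N form) for every
repulsive finite-range radial v with 0 < a < ∞ and every ε > 0: for all small ρ there are κ, M > 0
such that for all large N there is δ > 0 with: every Jastrow state Ψ_φ ∈ 𝓙(N,L), L = (N/ρ)^(1/3),
with periodicEnergy ≤ E_J(N,L) + δ has, at every torus mode k = 2πn/L with M/L ≤ |k| ≤ κ√(ρa),
Fourier defect |k|·∫(1−φ(x))cos(k·x)dx within relative ε of 2√(πa/ρ) (= 2π²·√(a/π³ρ), the Riesz-2 /
Reatto–Chester class with c = √(16πρa), ħ = 2m = 1; no other exponent and no cut-off below the box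
is near-optimal). [difficulty: XL] (why it might fail: needs S_φ(k) of the φ-gas as a functional of
the tail down to k ≈ M/L (perfect-screening sum rules for a hard-core + Riesz-2 gas: open) and
band-by-band strict convexity with the 3-body term; anisotropic or corner (r ≈ L/2) distortions may
cost o(8πρa) per mode.) [ReattoChester1967, CampbellFeenberg1969, Griffin1993, LebleSerfaty2017,
Serfaty2024, arXiv:2603.13084]
#3 OptimalJastrowBEC (crux) — (card D3) for every repulsive finite-range radial v there is ρ₀ > 0
such that for 0 < ρ < ρ₀ there is c > 0 with: for all large N there is δ > 0 such that every Jastrow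
state Ψ_φ ∈ 𝓙(N,L), L = (N/ρ)^(1/3), with periodicEnergy v Ψ_φ ≤ E_J(N,L) + δ has constant-mode
occupation ⟨Ψ_φ, n₀Ψ_φ⟩ ≥ cN. For positive product states n₀/N is a Widom-insertion ratio
⟨e^(−U(x)−U(x′))⟩/⟨e^(−2U(x))⟩ of the classical gas |Ψ_φ|² (PenroseOnsager1956 §6, Reatto1969);
Gaussian level n₀/N ≈ exp(−ρ∫|û|²S đk) = exp(−O(√(ρa³))) for the Riesz-2 tail. The elementary anchor
bound n₀/N ≥ (1 − (N−1)∫(1−φ²)/L³)² of route BECParentAnchor is void here ((N−1)∫(1−φ²)/L³ → ∞ for a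
tail kept to the box): this crux is the long-range regime those items exclude. [deps:
JastrowTailRigidity] [difficulty: XL] (why it might fail: near-optimality controls φ only through
the quadratic form; BEC needs exponential moments of the insertion energy U = Σu(x−y_j) of a
hard-core + 1/r² gas (not of positive type globally), i.e. an infrared bound S(k) ≲ k/(ρβ) for the
φ-gas uniformly in N.) [Reatto1969, PenroseOnsager1956, FrohlichPark1978, LebleSerfaty2017,
ReattoChester1967]
#4 JastrowLHYSharp (crux) — (card D4, re-aimed after BastiEtAl2026; OUTSIDE the deciding chain,
independent value) the pair-product manifold alone is Lee–Huang–Yang sharp: for every repulsive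
finite-range radial v with a < ∞ (hard spheres included) and every ε > 0, for all small ρ,
eventually in N, E_J(N,L) ≤ 4πρa[1 + (128/(15√π) + ε)√(ρa³)]·N with L = (N/ρ)^(1/3). Known: pure
cut-off Jastrow gives LHY ORDER with a wrong constant (BastiEtAl2024; arXiv:2603.13084 p.2), the LHY
constant for hard spheres needs a Jastrow∘Bogoliubov Fock state (arXiv:2603.13084 Thm 1.1), and the
pure-Jastrow version with the pair factor extended beyond the healing length is called 'quite a
challenge' there (pp. 4–5); matching lower bound FournaisSolovej2020 / FournaisSolovej2022. [deps:
JastrowTailRigidity] [difficulty: XL] (why it might fail: inf over pair-product states may miss part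
of the LHY constant (the 3-body kinetic cross term must be o(ρa√(ρa³)) per particle after
optimisation — true at HNC/EL closure level only; quasi-free states provably miss it,
ErdosSchleinYau2008/YauYin2009 needed cubic terms).) [arXiv:2603.13084, BastiEtAl2024,
BastiCenatiempoSchlein2021, ErdosSchleinYau2008, YauYin2009, FournaisSolovej2022,
CampbellFeenberg1969, LSSY2005]
#5 JastrowShadowTransfer (crux) — (BRIDGE — the explicitly CONDITIONAL link, delegated by the card
to riesz-shadow-harmonic-extension R3 / relative-fisher-landscape-transfer /
riccati-cluster-ghost-plasma) JastrowTailRigidity → OptimalJastrowBEC → for every repulsive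
finite-range v, near-minimisers of the FULL periodic energy have constant-mode occupation ≥ cN at
all small ρ (verbatim the PeriodicBEC body, stmt-AtomisticToContinuum-0826). Intended mechanism: Ψ₀
= Ψ_(φ*)·Φ with φ* energy-optimal; optimality makes the residual (H − E_J)Ψ_(φ*) orthogonal to the
tangent space of 𝓙 (all pair excitations), so the dressing Φ is genuinely ≥ 3-body; the bet is that
its Palm / teleportation cost is bounded uniformly in N once the optimal Riesz-2 pair part (which
condenses by OptimalJastrowBEC and screens by JastrowTailRigidity) has been divided out. [deps:
JastrowTailRigidity, OptimalJastrowBEC] [difficulty: open-problem] (why it might fail: no transfer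
of condensation from a reference state to Ψ₀ is known at the box scale (KineticGapLengthScalesNarrow
(3): energy windows certify c ≤ 1/(M+1)); without a structural bound on Ψ₀/Ψ_(φ*) this is
PeriodicBEC (stmt-0826) in disguise.) [LSSY2005, Fournais2020, arXiv:2603.20776, Reatto1969,
Literature.Barriers.AtomisticToContinuum.KineticGapLengthScalesNarrow,
Literature.Barriers.AtomisticToContinuum.EnergyAsymptoticsWithoutCondensationNarrow]
#6 BoundaryTransferWeak (crux) — (shared item stmt-AtomisticToContinuum-0827, verbatim; home route
BECPeriodicReduction, wanted by 47 routes, grounded + checked) for each repulsive finite-range v,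
constant-mode BEC of near-minimisers of the periodic energy at all small ρ implies the conjunct's
Dirichlet, mode-free HasGroundStateBEC v ρ at all small ρ. [deps: JastrowShadowTransfer]
[difficulty: L] (why it might fail: near-minimiser slacks are O(1) while Dirichlet and periodic
energies differ by a wall term ≫ N/L², so no energy-comparison proof; a structural
(Neumann-bracketing + mode-free criterion) transfer is not in print (only the energy analogue, LSSY
Ch. 2).) [LSSY2005, Fournais2020, Robinson1976]
#9 JastrowInfLeadingOrder (support) — (non-vacuity, provable now) Dyson–LSSY leading-order bound for
the Jastrow infimum: for finite-range v with a < ∞ there are C, c > 0 such that for N ≥ 2, 0 < L,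
2R₀ < L and a/b ≤ c (ρ₁ = (N−1)/L³, b = (4πρ₁/3)^(−1/3)): E_J(N,L) ≤ 4πρ₁a(1 + C a/b)N. Same trial
state as the in-tree proof of LSSY2005_upperBound_periodic (IsPairProfile.trialState with cut-off
b/4): replace periodicGroundStateEnergy_le by iInf_le over the manifold data. Certifies E_J < ⊤ in
the dilute regime, so the near-optimality hypotheses of ranks 2–4 are not vacuous. [difficulty:
provable-now] [LSSY2005, Dyson1957]

TWO-LAYER PLAN. Foreseen glued splits (none filed now; k ≤ 3, depth 1): JastrowTailRigidity ⇐
JastrowFunctionalTL (card D1: thermodynamic limit of E_J on the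
Riesz-s tailed classes 𝓕_(s,β), 0 < s < 3, including the 3-point term, from LebleSerfaty2017 local
laws) → TailStationarity (only
(s,β) = (2, √(a/π³ρ)) is stationary; scale-by-scale excess ≥ c₁·8πρa·#{modes}·d((s,β),(2,β*))²) →
JastrowTailRigidity.
OptimalJastrowBEC ⇐ JastrowTailRigidity → RieszTailCondenses (BEC of every Jastrow state whose modes
below κ√(ρa) are Riesz-2 within ε: infrared
bound S(k) ≲ k for the φ-gas + exponential moments of the insertion energy) → OptimalJastrowBEC.
JastrowLHYSharp ⇐ JastrowFunctionalTL →
RieszTrialEvaluation (energy of the profile (scattering core) × (Riesz-2 tail) to relative o(√(ρa³))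
by long-range-gas local laws instead of a
cluster expansion) → JastrowLHYSharp. JastrowShadowTransfer ⇐ OptimalPairOrthogonality (the residual
of the optimal Jastrow state is orthogonal
to all pair excitations) → DressingTeleportBound (bounded Palm cost of Ψ₀/Ψ_(φ*)) →
JastrowShadowTransfer.

KILL CRITERIA. ¬JastrowTailRigidity by an explicit competitor (a cut-off or s ≠ 2 tailed pair factor
whose energy is within o(1) TOTAL of E_J for arbitrarily
large N, or a proof that inf_𝓙 is approached by short-range factors) closes the route
`refuted:JastrowTailRigidity` — the mechanism is dead
even if OptimalJastrowBEC survives (a misstated constant/window is instead repaired by a new item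
JastrowTailRigidityR + re-certified glue).
¬OptimalJastrowBEC kills the route and, physically, the Jastrow picture of the condensate.
¬JastrowLHYSharp (inf over pair-product states misses
the LHY constant) does NOT touch the deciding chain: drop rank 4 (`--drop`, it is not load-bearing)
and record the negative; the manifold is then
infrared-sharp but not LHY-sharp — still new. ¬JastrowShadowTransfer cannot be refuted without
refuting PeriodicBEC-type statements; if
PeriodicBEC (stmt-0826) is proved elsewhere the bridge and rank 6 are moot and the route closes
`superseded`, ranks 2–4 surviving as structure
theorems. ¬BoundaryTransferWeak breaks this and 46 other routes.

NOT DECOMPOSED YET. The thermodynamic-limit functional (card D1) and the Riesz-class parametrisation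
𝓕_(s,β) — layer-2 children once rank 2 is staffed; the
quantitative excess bound (slack θ·8πρa·(L/R)³ ⇒ accuracy at scale R) — stated informally only, the
filed rank 2 is its δ → 0 shadow; the
Jackson–Feenberg gradient identity (arXiv:2603.13084 (1.7)) on the torus for C¹ pair factors with
hard core (card D5, a `--supports
JastrowTailRigidity` lemma, not an item, since IsPairProfile is only C¹ and the Δu form is
unavailable); hard-core versus soft-core case splits;
the value of c in OptimalJastrowBEC (expected 1 − O(√(ρa³))); everything about the dressing Φ =
Ψ₀/Ψ_(φ*) beyond the bridge's statement
(belongs to the bridge's owner cards / route BECRieszShadow's TeleportEntropyBound).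

CHEAPEST FALSIFIER. Variational Monte Carlo (kit, not run in this one-shot planning seat): N =
10³–10⁴ hard spheres at ρa³ = 10⁻³ on the torus, pair factor =
(1 − a/r)₊-core × Riesz-s tail of amplitude β cut off at L/2, scan (s, β): (i) is the energy minimum
at s = 2, β ≈ √(a/π³ρ)? (ii) does E(s) − E(2)
stay ≳ 8πρa·#{modes below 1/R} when the tails differ only beyond R? (iii) is E_J/N below 4πρa(1 +
1.2·(128/15√π)√(ρa³))? A flat landscape in s at
resolution 8πρa TOTAL, or E_J/N stuck above LHY by a fixed fraction of the correction, kills ranks 2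
/ 4 respectively in practice. Lookup
falsifiers already run: is the pure-Jastrow LHY bound in print? — no (arXiv:2603.13084 pp. 2, 4–5
read: the opposite is stated); is an HNC/EL
computation contradicting LHY-sharpness of the optimal Jastrow in print? — crossref search (12 rows)
shows only closure-level agreement claims.

NUMBERS. LHY: e(ρ) = 4πaρ²[1 + (128/15√π)√(ρa³) + …], 128/(15√π) ≈ 4.814; hard spheres: upper bound
with this constant + C(ρa³)^(1/2+δ)
(arXiv:2603.13084 Thm 1.1, Jastrow∘Bogoliubov Fock state, grand canonical, 586 pp.); pure cut-off
Jastrow (ℓ = c(ρa)^(−1/2)): LHY order, wrong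
constant (BastiEtAl2024); Dyson/LSSY product state: 4πρ₁a(1 + C a/b), b = ρ^(−1/3) gives (ρa³)^(1/3)
(arXiv:2603.13084 (1.10)–(1.11)). Units
ħ = 2m = 1: μ₀ = 8πρa, c = √(16πρa), healing length (16πρa)^(−1/2), Reatto–Chester amplitude
mc/(2π²ħρ) = c/(4π²ρ) = √(a/π³ρ) (Griffin1993 (9.3)),
predicted |k|·(1−φ)^(k) → 2√(πa/ρ); Bogoliubov S(k) = k/√(k² + 16πρa); depletion (8/3√π)√(ρa³).
Energy-window barrier: δ > 4π²M²N/L² ⇒ c ≤ 1/(M+1)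
(KineticGapLengthScalesNarrow (3)); here every δ is existential after N. Items at open: 7 (5 cruxes,
1 support, 1 assembly).

DEFINITION REQUESTS. None needed to type the items (the Jastrow infimum E_J is inlined as an iInf
over the IsPairProfile.trialState data). Convenience notion requested
after open: `jastrowGroundStateEnergy v N L` (that iInf) in
Literature/MathematicalPhysics/QuantumManyBody; later (layer 2) `RieszTailedProfile s β`
for card D1.

Novelty: Searches (2026-08-15, this seat): `lit galaxy search "paired-phonon analysis" --star all` (5 rows:
Feenberg 1969 Theory of Quantum Fluids
panama:184666413858821, Marshak helium monograph, Binder MC volume, Croxton; pdf: Lee–Lee PRB 22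
(1980) three-particle distribution); `lit vsearch
"optimal Jastrow pair function … 1/r^2 … Euler–Lagrange … structure factor linear in k"` (10 docs;
book:griffin1993 p.183 (9.3) = the
Reatto–Chester tail, read); `lit search --source crossref "hypernetted chain Euler-Lagrange optimal
Jastrow dilute Bose gas Lee-Huang-Yang"` (12 rows:
Gartner et al. SciPost 2025, Zabolitzky 1980, Jackson–Lande–Lantto 1979 — closure-level physics
only); `lit frontier AtomisticToContinuum --since 2024`
(30 rows; Bose-gas descendants arXiv:2510.20493, 2603.20776, 2605.06844 (read pp.1–4: simplified LHY
upper bound for soft V, not Jastrow),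
2602.16566, doi:10.1016/j.aim.2026.110825); `lit bridges AtomisticToContinuum --cross any` (no
Riesz-gas/Bose-gas bridge); `lit read arXiv:2603.13084
pp.1–6` (Thm 1.1 and the pure-Jastrow remark); searchd `--source all` rc 75 twice (noted). Inherited
and re-checked: the card's audit-35 and the gen-1
review searches (s2 "hard sphere Bose gas upper bound Lee-Huang-Yang" ≥ 2023: arXiv:2603.13084,
2605.06844, 2405.03378, 2408.14222).
Nearest prior art found: ReattoChester1967 + CampbellFeenberg1969 (+ Jackson–Lande–Lantto 1979
doi:10.1016/0375-9474(79)90452-4, Krotscheck HNC-EL: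
the closure-level ANSWER s = 2, u ~ mc/π²ħρr²); Reatto196  [refs: 10.1016/j.aim.2026.110825, 10.1016/0375-9474(79, 2510.20493, 2603.13084, book:griffin1993, doi:10.1016/j.aim.2026.110825, doi:10.1016/0375-9474, ReattoChester1967, CampbellFeenberg1969, Reatto1969, BastiEtAl2024, BastiEtAl2026, LauritsenSeiringer2024, LebleSerfaty2017, Serfaty2024]

Barriers (technique_class: jastrow-variational euler-lagrange riesz-gas): - technique_class: jastrow-variational euler-lagrange riesz-gas
- Literature.Barriers.AtomisticToContinuum.EnergyAsymptoticsWithoutCondensation: confronted, not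
evaded: energy ⇒ structure is claimed ONLY on the pair-product manifold, whose members are positive
product states — the 1-D witness (Lieb–Liniger: the optimal 1-D Jastrow is the log gas, s = 0, no
BEC) is consistent with ranks 2–3 being d = 3 statements, and the 3-D witnesses (phase textures,
boosts, number filters) are not tangent to the manifold; the inference to Ψ₀ is isolated in the
bridge (rank 5), which is where the barrier bites and is labelled conditional.
- Literature.Barriers.AtomisticToContinuum.EnergyAsymptoticsWithoutCondensationNarrow: ranks 2–4
infer structure of EXPLICIT trial states from the energy functional restricted to a manifold (second
variation mode by mode), not HasGroundStateBEC from two orders of e₀(ρ); rank 5 no longer draws on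
LHY-accuracy at all (gen-2 change) — its hypotheses are structural (tail class + condensation of the
reference gas); it does not evade the entry's open d = 3 question, the bet is positivity + Riesz-2
structure of the divided-out pair part.
- Literature.Barriers.AtomisticToContinuum.KineticGapLengthScalesNarrow: ranks 2–4 never localise in
boxes (scale-by-scale = bands of torus modes of ONE global state) and the Galilei-boost witness of
conjunct (2) is off-manifold (complex phase); every δ in ranks 2, 3, 5 is existential AFTER N, so no
statement here is an energy-win

History (route lifecycle, newest last):
- 2026-08-26T03:39:38Z · DORMANT — reconciler: no traction for 8.3 d (last activity item-evidence-added at 2026-08-17T19:22:54Z); parked, not closed — `ledger route dormant route-AtomisticToConti (operator:999:2513897)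
- 2026-08-29T03:22:10Z · REACTIVATED — reconciler: reactivated — activity statement-checked at 2026-08-29T01:17:37Z after parking at 2026-08-26T03:39:38Z (operator:999:4093623)
- 2026-08-29T19:27:37Z · DORMANT — census g0: costume|duplicate of —; reader census-reader-32-g0 (operator:999:918884)

sub-problem: BoseEinsteinCondensation · status: dormant · opened planner-plancard-AtomisticToContinuum-BoseEin-7e90b8c6-g2-0 2026-08-15T19:01:31Z · rev 3 · ledger route-AtomisticToContinuum-BECJastrowEulerLagrange
GENERATED by the gate from the ledger (D-0016/17). Provers cite these decls: `theorem foo : Summit.AtomisticToContinuum.BoseEinsteinCondensation.Theses.BECJastrowEulerLagrange.<Decl> := …` in Summits/AtomisticToContinuum/BoseEinsteinCondensation/Theorems/<Name>.lean.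
-/

namespace Summit.AtomisticToContinuum.BoseEinsteinCondensation.Theses.BECJastrowEulerLagrange

open scoped BigOperators Topology Manifold Classical MeasureTheory ProbabilityTheory Matrix InnerProductSpace ComplexConjugate ContinuousMap
open Filter Set Function TopologicalSpace MeasureTheory

attribute [summit_statement] _root_.BoseEinsteinCondensation

/-- item stmt-AtomisticToContinuum-13400 · crux · rank 2 · open · by planner
why it might fail: needs S_φ(k) of the φ-gas as a functional of the tail down to k ≈ M/L (perfect-screening sum rules for a hard-core + Riesz-2 gas: open) and band-by-band strict convexity with the 3-body term; anisotropic or corner (r ≈ L/2) distortions may cost o(8πρa) per mode.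
sources: ReattoChester1967, CampbellFeenberg1969, Griffin1993, LebleSerfaty2017, Serfaty2024, arXiv:2603.13084
[crux] (card D2, TAIL THEOREM, uniform-in-N form) for every repulsive finite-range radial v with 0 <
a < ∞ and every ε > 0: for all small ρ there are κ, M > 0 such that for all large N there is δ > 0
with: every Jastrow state Ψ_φ ∈ 𝓙(N,L), L = (N/ρ)^(1/3), with periodicEnergy ≤ E_J(N,L) + δ has, at
every torus mode k = 2πn/L with M/L ≤ |k| ≤ κ√(ρa), Fourier defect |k|·∫(1−φ(x))cos(k·x)dx within
relative ε of 2√(πa/ρ) (= 2π²·√(a/π³ρ), the Riesz-2 / Reatto–Chester class with c = √(16πρa), ħ = 2m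
= 1; no other exponent and no cut-off below the box is near-optimal). [difficulty: XL] -/
@[route_item "route-AtomisticToContinuum-BECJastrowEulerLagrange", crux]
def JastrowTailRigidity : Prop :=
  ∀ v : ℝ → ENNReal, Literature.MathematicalPhysics.QuantumManyBody.BoseGas.IsRepulsiveFiniteRange v → Literature.MathematicalPhysics.QuantumManyBody.BoseGas.scatteringLength v ≠ ⊤ → 0 < Literature.MathematicalPhysics.QuantumManyBody.BoseGas.scatteringLength v → ∀ ε : ℝ, 0 < ε → ∃ ρ₀ : ℝ, 0 < ρ₀ ∧ ∀ ρ : ℝ, 0 < ρ → ρ < ρ₀ → ∃ κ M : ℝ, 0 < κ ∧ 0 < M ∧ ∀ᶠ N : ℕ in Filter.atTop, ∃ δ : ENNReal, 0 < δ ∧ ∀ (hL : 0 < (Literature.MathematicalPhysics.QuantumManyBody.BoseGas.sideLength ρ N)) (b : ℝ) (φ : EuclideanSpace ℝ (Fin 3) → ℝ) (hφ : Literature.MathematicalPhysics.QuantumManyBody.BoseGas.IsPairProfile b φ) (hbL : 2 * b < (Literature.MathematicalPhysics.QuantumManyBody.BoseGas.sideLength ρ N)) (hν : 0 < Literature.MathematicalPhysics.QuantumManyBody.BoseGas.jastrowNormR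 (Literature.MathematicalPhysics.QuantumManyBody.BoseGas.sideLength ρ N) φ (Finset.univ : Finset (Fin N))), Literature.MathematicalPhysics.QuantumManyBody.BoseGas.periodicEnergy v (hφ.trialState hL hbL hν) ≤ (⨅ (hL : 0 < (Literature.MathematicalPhysics.QuantumManyBody.BoseGas.sideLength ρ N)) (b : ℝ) (φ : EuclideanSpace ℝ (Fin 3) → ℝ) (hφ : Literature.MathematicalPhysics.QuantumManyBody.BoseGas.IsPairProfile b φ) (hbL : 2 * b < (Literature.MathematicalPhysics.QuantumManyBody.BoseGas.sideLength ρ N)) (hν : 0 < Literature.MathematicalPhysics.QuantumManyBody.BoseGas.jastrowNormR (Literature.MathematicalPhysics.QuantumManyBody.BoseGas.sideLength ρ N) φ (Finset.univ : Finset (Fin N))), Literature.MathematicalPhysics.QuantumManyBody.BoseGas.periodicEnergy v (hφ.trialState hL hbL hν)) + δ → ∀ n : Fin 3 → ℤ, M / Literature.MathematicalPhysics.QuantumManyBody.BoseGas.sideLength ρ N ≤ ‖(Literature.MathematicalPhysics.QuantumManyBody.BoseGas.latticeVec (2 * Real.pi / Literature.MathematicalPhysics.QuantumManyBody.BoseGas.sideLength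 ρ N) n)‖ → ‖(Literature.MathematicalPhysics.QuantumManyBody.BoseGas.latticeVec (2 * Real.pi / Literature.MathematicalPhysics.QuantumManyBody.BoseGas.sideLength ρ N) n)‖ ≤ κ * Real.sqrt (ρ * (Literature.MathematicalPhysics.QuantumManyBody.BoseGas.scatteringLength v).toReal) → |‖(Literature.MathematicalPhysics.QuantumManyBody.BoseGas.latticeVec (2 * Real.pi / Literature.MathematicalPhysics.QuantumManyBody.BoseGas.sideLength ρ N) n)‖ * (∫ x : EuclideanSpace ℝ (Fin 3), (1 - φ x) * Real.cos (inner ℝ (Literature.MathematicalPhysics.QuantumManyBody.BoseGas.latticeVec (2 * Real.pi / Literature.MathematicalPhysics.QuantumManyBody.BoseGas.sideLength ρ N) n) x)) - (2 * Real.sqrt (Real.pi * (Literature.MathematicalPhysics.QuantumManyBody.BoseGas.scatteringLength v).toReal / ρ))| ≤ ε * (2 * Real.sqrt (Real.pi * (Literature.MathematicalPhysics.QuantumManyBody.BoseGas.scatteringLength v).toReal / ρ))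

/-- item stmt-AtomisticToContinuum-13401 · crux · rank 3 · open · by planner
why it might fail: near-optimality controls φ only through the quadratic form; BEC needs exponential moments of the insertion energy U = Σu(x−y_j) of a hard-core + 1/r² gas (not of positive type globally), i.e. an infrared bound S(k) ≲ k/(ρβ) for the φ-gas uniformly in N.
sources: Reatto1969, PenroseOnsager1956, FrohlichPark1978, LebleSerfaty2017, ReattoChester1967
[crux] (card D3) for every repulsive finite-range radial v there is ρ₀ > 0 such that for 0 < ρ < ρ₀
there is c > 0 with: for all large N there is δ > 0 such that every Jastrow state Ψ_φ ∈ 𝓙(N,L), L =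
(N/ρ)^(1/3), with periodicEnergy v Ψ_φ ≤ E_J(N,L) + δ has constant-mode occupation ⟨Ψ_φ, n₀Ψ_φ⟩ ≥
cN. For positive product states n₀/N is a Widom-insertion ratio ⟨e^(−U(x)−U(x′))⟩/⟨e^(−2U(x))⟩ of
the classical gas |Ψ_φ|² (PenroseOnsager1956 §6, Reatto1969); Gaussian level n₀/N ≈ exp(−ρ∫|û|²S đk)
= exp(−O(√(ρa³))) for the Riesz-2 tail. The elementary anchor bound n₀/N ≥ (1 − (N−1)∫(1−φ²)/L³)² of
route BECParentAnchor is void here ((N−1)∫(1−φ²)/L³ → ∞ for a tail kept to the box): this crux is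
the long-range regime those items exclude. [deps: JastrowTailRigidity] [difficulty: XL] -/
@[route_item "route-AtomisticToContinuum-BECJastrowEulerLagrange", crux]
def OptimalJastrowBEC : Prop :=
  ∀ v : ℝ → ENNReal, Literature.MathematicalPhysics.QuantumManyBody.BoseGas.IsRepulsiveFiniteRange v → ∃ ρ₀ : ℝ, 0 < ρ₀ ∧ ∀ ρ : ℝ, 0 < ρ → ρ < ρ₀ → ∃ c : ℝ, 0 < c ∧ ∀ᶠ N : ℕ in Filter.atTop, ∃ δ : ENNReal, 0 < δ ∧ ∀ (hL : 0 < (Literature.MathematicalPhysics.QuantumManyBody.BoseGas.sideLength ρ N)) (b : ℝ) (φ : EuclideanSpace ℝ (Fin 3) → ℝ) (hφ : Literature.MathematicalPhysics.QuantumManyBody.BoseGas.IsPairProfile b φ) (hbL : 2 * b < (Literature.MathematicalPhysics.QuantumManyBody.BoseGas.sideLength ρ N)) (hν : 0 < Literature.MathematicalPhysics.QuantumManyBody.BoseGas.jastrowNormR (Literature.MathematicalPhysics.QuantumManyBody.BoseGas.sideLength ρ N) φ (Finset.univ : Finset (Fin N))), Literature.MathematicalPhysics.QuantumManyBody.BoseGas.periodicEnergy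 v (hφ.trialState hL hbL hν) ≤ (⨅ (hL : 0 < (Literature.MathematicalPhysics.QuantumManyBody.BoseGas.sideLength ρ N)) (b : ℝ) (φ : EuclideanSpace ℝ (Fin 3) → ℝ) (hφ : Literature.MathematicalPhysics.QuantumManyBody.BoseGas.IsPairProfile b φ) (hbL : 2 * b < (Literature.MathematicalPhysics.QuantumManyBody.BoseGas.sideLength ρ N)) (hν : 0 < Literature.MathematicalPhysics.QuantumManyBody.BoseGas.jastrowNormR (Literature.MathematicalPhysics.QuantumManyBody.BoseGas.sideLength ρ N) φ (Finset.univ : Finset (Fin N))), Literature.MathematicalPhysics.QuantumManyBody.BoseGas.periodicEnergy v (hφ.trialState hL hbL hν)) + δ → ENNReal.ofReal (c * N) ≤ Literature.MathematicalPhysics.QuantumManyBody.BoseGas.condensateOccupation N (Literature.MathematicalPhysics.QuantumManyBody.BoseGas.sideLength ρ N) (hφ.trialState hL hbL hν).ψ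

/-- item stmt-AtomisticToContinuum-13402 · crux · rank 4 · open · by planner
why it might fail: inf over pair-product states may miss part of the LHY constant (the 3-body kinetic cross term must be o(ρa√(ρa³)) per particle after optimisation — true at HNC/EL closure level only; quasi-free states provably miss it, ErdosSchleinYau2008/YauYin2009 needed cubic terms).
sources: arXiv:2603.13084, BastiEtAl2024, BastiCenatiempoSchlein2021, ErdosSchleinYau2008, YauYin2009, FournaisSolovej2022
[crux] (card D4, re-aimed after BastiEtAl2026; OUTSIDE the deciding chain, independent value) the
pair-product manifold alone is Lee–Huang–Yang sharp: for every repulsive finite-range radial v with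
a < ∞ (hard spheres included) and every ε > 0, for all small ρ, eventually in N, E_J(N,L) ≤ 4πρa[1 +
(128/(15√π) + ε)√(ρa³)]·N with L = (N/ρ)^(1/3). Known: pure cut-off Jastrow gives LHY ORDER with a
wrong constant (BastiEtAl2024; arXiv:2603.13084 p.2), the LHY constant for hard spheres needs a
Jastrow∘Bogoliubov Fock state (arXiv:2603.13084 Thm 1.1), and the pure-Jastrow version with the pair
factor extended beyond the healing length is called 'quite a challenge' there (pp. 4–5); matching
lower bound FournaisSolovej2020 / FournaisSolovej2022. [deps: JastrowTailRigidity] [difficulty: XL] -/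
@[route_item "route-AtomisticToContinuum-BECJastrowEulerLagrange"]
def JastrowLHYSharp : Prop :=
  ∀ v : ℝ → ENNReal, Literature.MathematicalPhysics.QuantumManyBody.BoseGas.IsRepulsiveFiniteRange v → Literature.MathematicalPhysics.QuantumManyBody.BoseGas.scatteringLength v ≠ ⊤ → ∀ ε : ℝ, 0 < ε → ∃ ρ₀ : ℝ, 0 < ρ₀ ∧ ∀ ρ : ℝ, 0 < ρ → ρ < ρ₀ → ∀ᶠ N : ℕ in Filter.atTop, (⨅ (hL : 0 < (Literature.MathematicalPhysics.QuantumManyBody.BoseGas.sideLength ρ N)) (b : ℝ) (φ : EuclideanSpace ℝ (Fin 3) → ℝ) (hφ : Literature.MathematicalPhysics.QuantumManyBody.BoseGas.IsPairProfile b φ) (hbL : 2 * b < (Literature.MathematicalPhysics.QuantumManyBody.BoseGas.sideLength ρ N)) (hν : 0 < Literature.MathematicalPhysics.QuantumManyBody.BoseGas.jastrowNormR (Literature.MathematicalPhysics.QuantumManyBody.BoseGas.sideLength ρ N) φ (Finset.univ : Finset (Fin N))), Literature.MathematicalPhysics.QuantumManyBody.BoseGas.periodicEnergy v (hφ.trialState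 hL hbL hν)) ≤ ENNReal.ofReal (4 * Real.pi * ρ * (Literature.MathematicalPhysics.QuantumManyBody.BoseGas.scatteringLength v).toReal * (1 + (128 / (15 * Real.sqrt Real.pi) + ε) * Real.sqrt (ρ * (Literature.MathematicalPhysics.QuantumManyBody.BoseGas.scatteringLength v).toReal ^ 3)) * N)

/-- item stmt-AtomisticToContinuum-13403 · crux · rank 5 · open · by planner
why it might fail: no transfer of condensation from a reference state to Ψ₀ is known at the box scale (KineticGapLengthScalesNarrow (3): energy windows certify c ≤ 1/(M+1)); without a structural bound on Ψ₀/Ψ_(φ*) this is PeriodicBEC (stmt-0826) in disguise.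
sources: LSSY2005, Fournais2020, arXiv:2603.20776, Reatto1969, Literature.Barriers.AtomisticToContinuum.KineticGapLengthScalesNarrow, Literature.Barriers.AtomisticToContinuum.EnergyAsymptoticsWithoutCondensationNarrow
[crux] (BRIDGE — the explicitly CONDITIONAL link, delegated by the card to
riesz-shadow-harmonic-extension R3 / relative-fisher-landscape-transfer /
riccati-cluster-ghost-plasma) JastrowTailRigidity → OptimalJastrowBEC → for every repulsive
finite-range v, near-minimisers of the FULL periodic energy have constant-mode occupation ≥ cN at
all small ρ (verbatim the PeriodicBEC body, stmt-AtomisticToContinuum-0826). Intended mechanism: Ψ₀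
= Ψ_(φ*)·Φ with φ* energy-optimal; optimality makes the residual (H − E_J)Ψ_(φ*) orthogonal to the
tangent space of 𝓙 (all pair excitations), so the dressing Φ is genuinely ≥ 3-body; the bet is that
its Palm / teleportation cost is bounded uniformly in N once the optimal Riesz-2 pair part (which
condenses by OptimalJastrowBEC and screens by JastrowTailRigidity) has been divided out. [deps:
JastrowTailRigidity, OptimalJastrowBEC] [difficulty: open-problem] -/
@[route_item "route-AtomisticToContinuum-BECJastrowEulerLagrange", crux]
def JastrowShadowTransfer : Prop :=
  JastrowTailRigidity → OptimalJastrowBEC → ∀ v : ℝ → ENNReal, Literature.MathematicalPhysics.QuantumManyBody.BoseGas.IsRepulsiveFiniteRange v → ∃ ρ₀ : ℝ, 0 < ρ₀ ∧ ∀ ρ : ℝ, 0 < ρ → ρ < ρ₀ → ∃ c : ℝ, 0 < c ∧ ∀ᶠ N : ℕ in Filter.atTop, ∃ δ : ENNReal, 0 < δ ∧ ∀ Ψ : Literature.MathematicalPhysics.QuantumManyBody.BoseGas.PeriodicTrialState N (Literature.MathematicalPhysics.QuantumManyBody.BoseGas.sideLength ρ N), Literature.MathematicalPhysics.QuantumManyBody.BoseGas.periodicEnergy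 v Ψ ≤ Literature.MathematicalPhysics.QuantumManyBody.BoseGas.periodicGroundStateEnergy v N (Literature.MathematicalPhysics.QuantumManyBody.BoseGas.sideLength ρ N) + δ → ENNReal.ofReal (c * N) ≤ Literature.MathematicalPhysics.QuantumManyBody.BoseGas.condensateOccupation N (Literature.MathematicalPhysics.QuantumManyBody.BoseGas.sideLength ρ N) Ψ.ψ

/-- item stmt-AtomisticToContinuum-0827 · crux · rank 6 · open · by planner
why it might fail: near-minimiser slacks are O(1) while Dirichlet and periodic energies differ by a wall term ≫ N/L², so no energy-comparison proof; a structural (Neumann-bracketing + mode-free criterion) transfer is not in print (only the energy analogue, LSSY Ch. 2).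
sources: LSSY2005, Fournais2020, Robinson1976
[crux] BoundaryTransferWeak (mode-free boundary-condition transfer, per potential): for each
repulsive finite-range v, PeriodicBEC(v) implies ∃ρ₀>0 ∀ρ∈(0,ρ₀) HasGroundStateBEC v ρ (Dirichlet
ground state, λ_max(γ) ≥ cN via condensateNumber). Not glue: near-minimiser slacks are O(N/L²) while
Dirichlet/periodic energies differ by a boundary term ≫ N/L², so no energy-comparison proof;
expected route: Neumann bracketing of interior sub-boxes (−Δ_Dir ≥ ⊕−Δ_Neu, v ≥ 0) + a mode-free
criterion (λ_max ≥ tr γ²/N). Only the ENERGY analogue is in print (LiebSeiringerSolovejYngvason2005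
Ch. 2 after (2.8)). v ≡ 0: hypothesis and conclusion both true. -/
@[route_item "route-AtomisticToContinuum-BECJastrowEulerLagrange", crux]
def BoundaryTransferWeak : Prop :=
  ∀ v : ℝ → ENNReal, Literature.MathematicalPhysics.QuantumManyBody.BoseGas.IsRepulsiveFiniteRange v → (∃ ρ₀ : ℝ, 0 < ρ₀ ∧ ∀ ρ : ℝ, 0 < ρ → ρ < ρ₀ → ∃ c : ℝ, 0 < c ∧ ∀ᶠ N : ℕ in Filter.atTop, ∃ δ : ENNReal, 0 < δ ∧ ∀ Ψ : Literature.MathematicalPhysics.QuantumManyBody.BoseGas.PeriodicTrialState N (Literature.MathematicalPhysics.QuantumManyBody.BoseGas.sideLength ρ N), Literature.MathematicalPhysics.QuantumManyBody.BoseGas.periodicEnergy v Ψ ≤ Literature.MathematicalPhysics.QuantumManyBody.BoseGas.periodicGroundStateEnergy v N (Literature.MathematicalPhysics.QuantumManyBody.BoseGas.sideLength ρ N) + δ → ENNReal.ofReal (c * N) ≤ Literature.MathematicalPhysics.QuantumManyBody.BoseGas.condensateOccupation N (Literature.MathematicalPhysics.QuantumManyBody.BoseGas.sideLength ρ N) Ψ.ψ)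 → ∃ ρ₀ : ℝ, 0 < ρ₀ ∧ ∀ ρ : ℝ, 0 < ρ → ρ < ρ₀ → Literature.MathematicalPhysics.QuantumManyBody.BoseGas.HasGroundStateBEC v ρ

/-- item stmt-AtomisticToContinuum-13404 · support · rank 9 · open · by planner
sources: LSSY2005, Dyson1957
[support] (non-vacuity, provable now) Dyson–LSSY leading-order bound for the Jastrow infimum: for
finite-range v with a < ∞ there are C, c > 0 such that for N ≥ 2, 0 < L, 2R₀ < L and a/b ≤ c (ρ₁ =
(N−1)/L³, b = (4πρ₁/3)^(−1/3)): E_J(N,L) ≤ 4πρ₁a(1 + C a/b)N. Same trial state as the in-tree proof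
of LSSY2005_upperBound_periodic (IsPairProfile.trialState with cut-off b/4): replace
periodicGroundStateEnergy_le by iInf_le over the manifold data. Certifies E_J < ⊤ in the dilute
regime, so the near-optimality hypotheses of ranks 2–4 are not vacuous. [difficulty: provable-now] -/
@[route_item "route-AtomisticToContinuum-BECJastrowEulerLagrange"]
def JastrowInfLeadingOrder : Prop :=
  ∀ (v : ℝ → ENNReal) (R₀ : ℝ), Measurable v → (∀ r, R₀ < r → v r = 0) → Literature.MathematicalPhysics.QuantumManyBody.BoseGas.scatteringLength v ≠ ⊤ → ∃ C c : ℝ, 0 < C ∧ 0 < c ∧ ∀ (N : ℕ) (L : ℝ), 2 ≤ N → 0 < L → 2 * R₀ < L → (Literature.MathematicalPhysics.QuantumManyBody.BoseGas.scatteringLength v).toReal / ((4 * Real.pi * (((N : ℝ) - 1) / L ^ 3) / 3) ^ (-(1 : ℝ) / 3)) ≤ c → (⨅ (hL : 0 < L) (b : ℝ) (φ : EuclideanSpace ℝ (Fin 3) → ℝ) (hφ : Literature.MathematicalPhysics.QuantumManyBody.BoseGas.IsPairProfile b φ) (hbL : 2 * b < L) (hν : 0 < Literature.MathematicalPhysics.QuantumManyBody.BoseGas.jastrowNormR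 L φ (Finset.univ : Finset (Fin N))), Literature.MathematicalPhysics.QuantumManyBody.BoseGas.periodicEnergy v (hφ.trialState hL hbL hν)) ≤ ENNReal.ofReal (4 * Real.pi * (((N : ℝ) - 1) / L ^ 3) * (Literature.MathematicalPhysics.QuantumManyBody.BoseGas.scatteringLength v).toReal * (1 + C * ((Literature.MathematicalPhysics.QuantumManyBody.BoseGas.scatteringLength v).toReal / ((4 * Real.pi * (((N : ℝ) - 1) / L ^ 3) / 3) ^ (-(1 : ℝ) / 3)))) * N)

/-- item stmt-AtomisticToContinuum-13405 · assembly · rank 1 · open · by planner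
sources: LSSY2005, Reatto1969
[assembly] JastrowTailRigidity → OptimalJastrowBEC → JastrowShadowTransfer → BoundaryTransferWeak →
BoseEinsteinCondensation (the sub-problem Statement decl `_root_.BoseEinsteinCondensation`, by
name). -/
@[route_item "route-AtomisticToContinuum-BECJastrowEulerLagrange"]
def Assembly : Prop :=
  JastrowTailRigidity → OptimalJastrowBEC → JastrowShadowTransfer → BoundaryTransferWeak → _root_.BoseEinsteinCondensation

/-! D-0027 §2.1 — DECIDING THEOREM (planner-authored via `route open/edit --closes-file`; by planner-plancard-AtomisticToContinuum-BoseEin-7e90b8c6-g2-0 2026-08-15T19:01:31Z):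
its hypotheses are this route's items and its conclusion the sub-problem Statement (glue_lint), and it elaborates with this file. -/

@[closes "route-AtomisticToContinuum-BECJastrowEulerLagrange"] theorem closes (hT : JastrowTailRigidity) (hB : OptimalJastrowBEC) (hS : JastrowShadowTransfer) (hW : BoundaryTransferWeak) : _root_.BoseEinsteinCondensation :=
  fun v hv => hW v hv (hS hT hB v hv)

end Summit.AtomisticToContinuum.BoseEinsteinCondensation.Theses.BECJastrowEulerLagrange
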